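/-
Copyright (c) 2026 the pub-hodgecm-mathlib formalisation cell (harness21).  Prover seat hodgecm-mathlib-K2E3-p03 (g10) on the S4 valve (dealer K2E2-plan (g8), S4-R42∕R44:
road (J̃♭) FILE (TJ5) = the twisted tube Jacobian LETTER; layer [C] (C1)–(C2)): THE SWEEP ALGEBRA of the ε-twisted conjugation family along an abelian ε-stable subgroup.
Crux H413 `stmt-HodgeConjecture-24833`, lane `--supports … --as helper` (count-neutral).  THEOREMS ONLY (no `def`, no `instance`, no notation, no named-fact hypothesis, no `sorry`).
-/
import Literature.NumberTheory.Rogawski1990.Ch4Sec10   -- ★ `epsNorm ε δ = δ * ε δ`, `epsCentralizer ε δ` (= `{g | δ⁻¹ g δ = ε g}`)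
import HarnessLib

/-!
# R90-TF · S4 (Ch. 13.1–2) · road (J̃♭) «TWISTED TUBE JACOBIAN», FILE (TJ5) layer [C], part 1: THE SWEEP ALGEBRA

Dealt by the S4 dealer K2E2-plan (g8) (S4-R42 02:31Z; plan of record S4-R44 02:35Z: (TJ5) = [A] local twisted socket in transversal × window form ((TJ4), R90-C131-p04 (g3)) +
[B] model instantiation + [C] the sweep ∕ Haar factorisation along the norm on the abelian twisted torus).  THIS FILE = the pure group algebra of [C] (C1)–(C2), for ANY group
`G`, ANY endomorphism `ε : G →* G` and ANY subgroup `A ≤ G` that is ABELIAN, `ε`-STABLE and on which `ε` is INVOLUTIVE (at the datum: `G = G̃_v = GL₃(L_w)`, `ε = epsLoc`,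
`A = T̃ = Cent_{G̃_v}(γ₀)` for a regular `γ₀`; print [Rogawski1990, §3.11 pp. 34–35, §12.5 p. 186]):
* §1 THE NORM ON `A` (★ `epsNorm ε b = b · ε b`): `epsNorm_mul_of_mem` (`N(b b′) = N b · N b′`), `epsNorm_map_of_mem` (`N(ε b) = N b`), `map_epsNorm_of_mem` (`ε (N b) = N b`:
  the norm lands in the `ε`-fixed part), `epsNorm_mul_map_inv_self` (`N(r ε(r)⁻¹) = 1`: the coboundaries `C_A = (1−ε)A` die), **`epsNorm_sweep_of_mem`**
  (`N(r · b · ε(r)⁻¹) = N b`: the `ε`-twisted `A`-action SWEEPS each norm fibre), `mem_epsCentralizer_iff_map_eq_of_commute` (on `A`, `G̃_{δε} ∩ A = A^ε` for `δ ∈ A`).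
* §2 THE FAMILY: `twistedConj_mul` (`Ψ♭(x r, b) = Ψ♭(x, r b ε(r)⁻¹)` with `Ψ♭(x, b) = x b ε(x)⁻¹`, any `x r b`), `twistedConj_mul_of_mem_epsCentralizer` (`r ∈ G̃_{bε}` does not
  move `b`), and the SWEEP SET IDENTITY **`image_twistedConj_mul_eq`**: `Ψ♭ '' ((X * W) ×ˢ B) = Ψ♭ '' (X ×ˢ sweep(W, B))` with `sweep(W, B) = {r b ε(r)⁻¹ | r ∈ W, b ∈ B}` —
  the set-theoretic half of «the `T̃⧸T′`-directions of the quotient transversal sweep `b` inside its norm fibre» (census (TJ5) 02:33Z [C] (C2)).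
The measure half ((C3): Haar on `A` factorises along `N` over the sheets, ★ (Q1) slices; (C4): quotient mass by `A^ε`) is the sibling file `R90S4TwistedTubeSweepMeasure`.
HONEST LABEL: HC_CM is proved only modulo the 7 printed citations (2 remaining named inputs: hLiu418 = `stmt-HodgeConjecture-24832`, h413 = `stmt-HodgeConjecture-24833`)
until rung 0 closes; (J̃♭) OPEN; pure algebra, pays no socket.

## References
* [Rogawski1990] J. Rogawski, *Automorphic Representations of Unitary Groups in Three Variables*, Ann. of Math. Stud. 123 (1990), §3.11 pp. 34–35 (`ε`, `N`, `G̃_{δε}`,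
  Prop. 3.11.1–2), §12.5 p. 186 (the twisted Weyl integration formula: the sheets `Z̃T̃ᴺ ∖ T̃`).
* [Labesse1999] J.-P. Labesse, *Cohomologie, stabilisation et changement de base*, Astérisque 257 (1999), §III.1 (norm map and twisted classes on tori).
-/

set_option autoImplicit false
-- the mandated namespace repeats the single-problem summit's segment (`HodgeConjecture.HodgeConjecture`)
set_option linter.dupNamespace false

open Set
open scoped Pointwise
open Literature.NumberTheory.Rogawski1990.Ch4Sec10 (epsNorm epsCentralizer)

namespace Summit.HodgeConjecture.HodgeConjecture.R90.S4

variable {G : Type*} [Group G] (ε : G →* G)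

/-! ## §1 The norm `N b = b · ε b` on an abelian `ε`-stable subgroup where `ε` is involutive -/

section Norm

variable {A : Subgroup G} (hA : ∀ x ∈ A, ∀ y ∈ A, x * y = y * x) (hεA : ∀ x ∈ A, ε x ∈ A) (hε2 : ∀ x ∈ A, ε (ε x) = x)

/-- unfolding of ★ `epsNorm`: `N b = b · ε b`. [cite: Rogawski1990, §3.11 p. 34] -/
theorem epsNorm_def (b : G) : epsNorm ε b = b * ε b := rfl

include hA hεA in
/-- **`N` is multiplicative on `A`**: `N(b b′) = N b · N b′` for `b, b′ ∈ A` (`A` abelian, `ε`-stable). [cite: Rogawski1990, §3.11 p. 34] [cite: Labesse1999, §III.1] -/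
theorem epsNorm_mul_of_mem {b b' : G} (hb : b ∈ A) (hb' : b' ∈ A) : epsNorm ε (b * b') = epsNorm ε b * epsNorm ε b' := by
  rw [epsNorm_def, epsNorm_def, epsNorm_def, map_mul]
  have h := hA b' hb' (ε b) (hεA b hb)
  calc b * b' * (ε b * ε b') = b * (b' * ε b) * ε b' := by simp only [mul_assoc]
    _ = b * (ε b * b') * ε b' := by rw [h]
    _ = b * ε b * (b' * ε b') := by simp only [mul_assoc]

include hA hεA hε2 in
/-- **`N(ε b) = N b`** on `A` (`ε` involutive on `A`). [cite: Rogawski1990, §3.11 p. 34] -/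
theorem epsNorm_map_of_mem {b : G} (hb : b ∈ A) : epsNorm ε (ε b) = epsNorm ε b := by
  rw [epsNorm_def, epsNorm_def, hε2 b hb]
  exact (hA b hb (ε b) (hεA b hb)).symm

include hA hεA hε2 in
/-- **`ε (N b) = N b`** on `A`: the norm lands in the `ε`-fixed part `A^ε`. [cite: Rogawski1990, §3.11 Prop. 3.11.2 p. 35] -/
theorem map_epsNorm_of_mem {b : G} (hb : b ∈ A) : ε (epsNorm ε b) = epsNorm ε b := by
  rw [epsNorm_def, map_mul, hε2 b hb]
  exact (hA b hb (ε b) (hεA b hb)).symm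

include hε2 in
/-- **the coboundaries die**: `N(r · ε(r)⁻¹) = 1` (`ε` involutive at `r`; no commutativity needed). [cite: Rogawski1990, §3.11 Prop. 3.11.1 p. 34] -/
theorem epsNorm_mul_map_inv_self {r : G} (hr : r ∈ A) : epsNorm ε (r * (ε r)⁻¹) = 1 := by
  rw [epsNorm_def, map_mul, map_inv, hε2 r hr, mul_assoc, inv_mul_cancel_left, mul_inv_cancel]

include hA hεA hε2 in
/-- **THE SWEEP PRESERVES THE NORM**: `N(r · b · ε(r)⁻¹) = N b` for `r, b ∈ A` — the `ε`-twisted action of `A` on itself moves `b` inside its norm fibre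
(the `(1−ε)A`-coset of `b`). [cite: Rogawski1990, §3.11 Prop. 3.11.1 p. 34; §12.5 p. 186] -/
theorem epsNorm_sweep_of_mem {r b : G} (hr : r ∈ A) (hb : b ∈ A) : epsNorm ε (r * b * (ε r)⁻¹) = epsNorm ε b := by
  have hεr : (ε r)⁻¹ ∈ A := A.inv_mem (hεA r hr)
  rw [epsNorm_mul_of_mem ε hA hεA (A.mul_mem hr hb) hεr, epsNorm_mul_of_mem ε hA hεA hr hb]
  -- `N((ε r)⁻¹) = (N (ε r))⁻¹ = (N r)⁻¹` on the abelian `A`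
  have hinv : epsNorm ε (ε r)⁻¹ = (epsNorm ε r)⁻¹ := by
    rw [epsNorm_def, epsNorm_def, map_inv, hε2 r hr, mul_inv_rev]
  rw [hinv]
  have hc : epsNorm ε r * epsNorm ε b = epsNorm ε b * epsNorm ε r :=
    hA _ (A.mul_mem hr (hεA r hr)) _ (A.mul_mem hb (hεA b hb))
  rw [hc, mul_assoc, mul_inv_cancel, mul_one]

/-- the sweep by an element of the kernel direction: `N(r · b · ε(r)⁻¹) = N b` rewritten as `N((r ε(r)⁻¹) · b) = N b` (`A` abelian). [cite: Rogawski1990, §3.11 p. 34] -/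
theorem mul_mul_map_inv_eq_of_mem (hA : ∀ x ∈ A, ∀ y ∈ A, x * y = y * x) (hεA : ∀ x ∈ A, ε x ∈ A) {r b : G} (hr : r ∈ A) (hb : b ∈ A) :
    r * b * (ε r)⁻¹ = (r * (ε r)⁻¹) * b := by
  rw [mul_assoc, mul_assoc, hA b hb _ (A.inv_mem (hεA r hr))]

/-- **on `A`, the `ε`-centraliser of `δ ∈ A` is the `ε`-fixed part**: for `g` commuting with `δ`, `g ∈ G̃_{δε} ↔ ε g = g` (★ `epsCentralizer ε δ = {g | δ⁻¹ g δ = ε g}`).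
[cite: Rogawski1990, §3.11 Prop. 3.11.2 p. 35] -/
theorem mem_epsCentralizer_iff_map_eq_of_commute {g δ : G} (hcomm : g * δ = δ * g) : g ∈ epsCentralizer ε δ ↔ ε g = g := by
  change (MulAut.conj δ⁻¹) g = ε g ↔ ε g = g
  have h : δ⁻¹ * g * δ = g := by rw [mul_assoc, hcomm, inv_mul_cancel_left]
  rw [MulAut.conj_apply, inv_inv, h]
  exact eq_comm

end Norm

/-! ## §2 The ε-twisted conjugation family `Ψ♭(x, b) = x · b · ε(x)⁻¹` and the sweep set identity -/

section Family

/-- **`Ψ♭(x r, b) = Ψ♭(x, r b ε(r)⁻¹)`** — right translation of the transversal variable by `r` sweeps the torus variable (any `x r b`).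
[cite: Rogawski1990, §12.5 p. 186] -/
theorem twistedConj_mul (x r b : G) : (x * r) * b * (ε (x * r))⁻¹ = x * (r * b * (ε r)⁻¹) * (ε x)⁻¹ := by
  rw [map_mul, mul_inv_rev]; simp only [mul_assoc]

/-- … in particular `r ∈ G̃_{bε}` does not move `b`: `Ψ♭(x r, b) = Ψ♭(x, b)` (★ `epsCentralizer`: `b⁻¹ r b = ε r`). [cite: Rogawski1990, §1.4 p. 4] -/
theorem twistedConj_mul_of_mem_epsCentralizer (x b : G) {r : G} (hr : r ∈ epsCentralizer ε b) : (x * r) * b * (ε (x * r))⁻¹ = x * b * (ε x)⁻¹ := by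
  have hr' : b⁻¹ * r * b = ε r := by
    have h : (MulAut.conj b⁻¹) r = ε r := hr
    rwa [MulAut.conj_apply, inv_inv] at h
  have hrb : r * b * (ε r)⁻¹ = b := by
    rw [← hr', mul_inv_rev, mul_inv_rev, inv_inv]
    simp only [mul_assoc, mul_inv_cancel_left]
  rw [twistedConj_mul, hrb]

/-- **THE SWEEP SET IDENTITY**: `Ψ♭ '' ((X · W) ×ˢ B) = Ψ♭ '' (X ×ˢ sweep(W, B))` with `sweep(W, B) = {r b ε(r)⁻¹ | r ∈ W, b ∈ B}` — the `W`-directions of the transversal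
are traded for the sweep of the torus window. [cite: Rogawski1990, §12.5 p. 186] -/
theorem image_twistedConj_mul_eq (X W B : Set G) :
    (fun p : G × G => p.1 * p.2 * (ε p.1)⁻¹) '' ((X * W) ×ˢ B) =
      (fun p : G × G => p.1 * p.2 * (ε p.1)⁻¹) '' (X ×ˢ ((fun q : G × G => q.1 * q.2 * (ε q.1)⁻¹) '' (W ×ˢ B))) := by
  ext g
  simp only [mem_image, mem_prod, Prod.exists, Set.mem_mul]
  constructor
  · rintro ⟨_, b, ⟨⟨x, hx, r, hr, rfl⟩, hb⟩, rfl⟩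
    exact ⟨x, r * b * (ε r)⁻¹, ⟨hx, r, b, ⟨hr, hb⟩, rfl⟩, (twistedConj_mul ε x r b).symm⟩
  · rintro ⟨x, _, ⟨hx, r, b, ⟨hr, hb⟩, rfl⟩, rfl⟩
    exact ⟨x * r, b, ⟨⟨x, hx, r, hr, rfl⟩, hb⟩, twistedConj_mul ε x r b⟩

/-- the sweep of a window by the `ε`-fixed part is trivial: `sweep(W, B) = B` as soon as `W ⊆ G̃_{bε}` for every `b ∈ B` and `1 ∈ W`. [cite: Rogawski1990, §1.4 p. 4] -/
theorem image_sweep_eq_of_subset_epsCentralizer {W B : Set G} (h1 : (1 : G) ∈ W) (hW : ∀ b ∈ B, W ⊆ (epsCentralizer ε b : Set G)) :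
    (fun q : G × G => q.1 * q.2 * (ε q.1)⁻¹) '' (W ×ˢ B) = B := by
  ext g
  simp only [mem_image, mem_prod, Prod.exists]
  constructor
  · rintro ⟨r, b, ⟨hr, hb⟩, rfl⟩
    have h := twistedConj_mul_of_mem_epsCentralizer ε 1 b (hW b hb hr)
    simp only [one_mul, map_one, inv_one, mul_one] at h
    rwa [h]
  · intro hg
    exact ⟨1, g, ⟨h1, hg⟩, by simp⟩

end Family

end Summit.HodgeConjecture.HodgeConjecture.R90.S4
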